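import Mathlib
import Summits.CriticalPhenomena.CardyFormulaZ2.Theorems.CardyMagicRigidityNestingRigidityBigLoopsExpMomentMeet
import Summits.CriticalPhenomena.CardyFormulaZ2.Theorems.CardyMagicRigidityNestingRigidityBigLoopsExpMomentBall
import HarnessLib

/-!
# Crux `NestingRigidity`, line `positive-cone-weight-doubling`: keystone K6 at ALL CENTRES and ALL
# SCALES with NO mesh constraint, for the loops meeting / inside a window, both lattices

Crux `Summit.CriticalPhenomena.CardyFormulaZ2.Theses.CardyMagicRigidity.NestingRigidity`
(stmt-CriticalPhenomena-4835), line `positive-cone-weight-doubling`, registered helper Ξ₂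
`uvFarBiteSq_expMoment_latticeEnsembles`.  Final form of the big-loop input of the multi-scale
bounds of the wave: for `E ∈ latticeEnsembles`, `s R η` (`0 < η ≤ R`) there is ONE constant `C` with
`E_δ[exp(s · #{u ∈ X_δ : trace u ∩ B̄(x, λR) ≠ ∅, diam (trace u) ≥ λη})] ≤ C` for EVERY centre `x`,
EVERY scale `λ > 0` and EVERY mesh `δ > 0` (registered anchor `expMoment_ncard_bigLoops_meeting_le_ball`),
and the same for the loops inside `B(x, λR)` (`expMoment_ncard_bigLoops_le_ball_free`).  No cited fact,
no definition:

* §1 loop families cut by a predicate under translations and dilations (set identities);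
* §2 PATHWISE near-translations (`exists_translate_loops_pathwise`: the loop set of `X_δ(ω)` is the
  translate by a `2δ`-close vector `b ∈ δℤ²`, resp. `δ𝕋`, of the loop set of `X_δ(ω − b)`,
  …BondTranslation / …SiteTranslation) and the DETERMINISTIC bound at lattice scale
  (`exists_ncard_loops_meeting_smallBall_le`): at most `M(K)` loops of `X_δ` meet a ball of radius
  `Kδ`, whatever its centre and the mesh (translate near `0`, dilate to mesh `1`
  (`loops_mul_latticeEnsembles`), `FirstMoment.exists_ncard_loops_meeting_le` at mesh `1`);
* §3 K6 for the loops MEETING a window at all scales at centre `0` (dilation covariance, from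
  `expMoment_ncard_bigLoops_meeting_le`), then at all centres (law-preserving near-translations
  `SiteTranslation.exists_near_translate_loops_latticeEnsembles`, window enlarged by `2λη ≥ 2δ`), the
  sub-lattice scales `λη < c₀δ` being covered by §2 (`#loops ≤ M`, `exp(sM)`); the confined count is
  dominated by the meeting count.
-/

noncomputable section

open MeasureTheory Set Filter Metric
open scoped Real Topology BigOperators

namespace Summit.CriticalPhenomena.CardyFormulaZ2.Cruxes.NestingRigidity.PositiveConeWeightDoubling

open Literature.Probability.RandomPlanarGeometry Literature.Probability.Percolation
  Literature.Probability.LatticeModels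
open Summit.CriticalPhenomena.CardyFormulaZ2.Cruxes.NestingRigidity.RingCloudTomography
open Summit.CriticalPhenomena.CardyFormulaZ2.Cruxes.NestingRigidity.MarkovCascadeOneGeneration
  (continuous_translate isometry_translate range_map_translate)
open Summit.CriticalPhenomena.CardyFormulaZ2.Cruxes.MagicFormulaT.LineSketch (imageOn_mul_injective)

namespace BigLoopsMeetBall

/-- The translation `z ↦ z + b` of the plane as a continuous map (local notation). -/
local notation3 "T[" b "]" => (⟨fun z : ℂ ↦ 1 * z + (b : ℂ), continuous_translate b⟩ : C(ℂ, ℂ))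

/-! ## §1 Loop families cut by a predicate under translations and dilations -/

/-- Cutting the image family by `Q` is the image of the family cut by the pulled-back predicate. -/
theorem sep_image_eq {f : UnbasedLoop ℂ → UnbasedLoop ℂ} (L : Set (UnbasedLoop ℂ))
    (Q Q' : UnbasedLoop ℂ → Prop) (hQ : ∀ u, Q (f u) ↔ Q' u) :
    {u ∈ f '' L | Q u} = f '' {u ∈ L | Q' u} := by
  ext u
  constructor
  · rintro ⟨⟨v, hv, rfl⟩, hq⟩
    exact ⟨v, ⟨hv, (hQ v).1 hq⟩, rfl⟩
  · rintro ⟨v, ⟨hv, hq⟩, rfl⟩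
    exact ⟨⟨v, hv, rfl⟩, (hQ v).2 hq⟩

/-- The translate `u + b` meets `B̄(x, ρ)` iff `u` meets `B̄(x − b, ρ)`. -/
theorem meets_translate_iff (b x : ℂ) (ρ : ℝ) (u : UnbasedLoop ℂ) :
    ((UnbasedLoop.map T[b] (isometry_translate b) u).range ∩ closedBall x ρ).Nonempty ↔
      (u.range ∩ closedBall (x - b) ρ).Nonempty := by
  rw [range_map_translate]
  constructor
  · rintro ⟨_, ⟨z, hz, rfl⟩, hz'⟩
    refine ⟨z, hz, ?_⟩
    rw [mem_closedBall, dist_eq_norm] at hz' ⊢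
    rwa [show z - (x - b) = z + b - x by ring]
  · rintro ⟨z, hz, hz'⟩
    refine ⟨z + b, ⟨z, hz, rfl⟩, ?_⟩
    rw [mem_closedBall, dist_eq_norm] at hz' ⊢
    rwa [show z + b - x = z - (x - b) by ring]

/-- The big-loop-meeting predicate under translation by the centre. -/
theorem bigMeet_translate_iff (b : ℂ) (ρ η : ℝ) (u : UnbasedLoop ℂ) :
    (((UnbasedLoop.map T[b] (isometry_translate b) u).range ∩ closedBall b ρ).Nonempty ∧
        η ≤ diam (UnbasedLoop.map T[b] (isometry_translate b) u).range) ↔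
      ((u.range ∩ closedBall (0 : ℂ) ρ).Nonempty ∧ η ≤ diam u.range) := by
  have hiso : Isometry fun z : ℂ ↦ z + b := Isometry.of_dist_eq fun x y ↦ by simp [dist_eq_norm]
  rw [meets_translate_iff, sub_self, range_map_translate, hiso.diam_image]

/-- The dilate `c · u` (`c > 0`) meets `B̄(0, cR)` iff `u` meets `B̄(0, R)`. -/
theorem meets_dilate_iff {c : ℝ} (hc : 0 < c) (R : ℝ) (u : UnbasedLoop ℂ) :
    ((UnbasedLoop.imageOn (fun z ↦ (c : ℂ) * z) univ u).range ∩ closedBall (0 : ℂ) (c * R)).Nonempty ↔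
      (u.range ∩ closedBall (0 : ℂ) R).Nonempty := by
  rw [UVExpMoments.range_imageOn_mul]
  have hn : ∀ z : ℂ, ‖(c : ℂ) • z‖ = c * ‖z‖ := fun z ↦ by
    rw [smul_eq_mul, norm_mul, Complex.norm_real, Real.norm_of_nonneg hc.le]
  constructor
  · rintro ⟨w, hw, hw'⟩
    obtain ⟨z, hz, rfl⟩ := Set.mem_smul_set.1 hw
    refine ⟨z, hz, ?_⟩
    rw [mem_closedBall, dist_zero_right] at hw' ⊢
    rw [hn] at hw'
    exact le_of_mul_le_mul_left hw' hc
  · rintro ⟨z, hz, hz'⟩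
    refine ⟨(c : ℂ) • z, Set.smul_mem_smul_set hz, ?_⟩
    rw [mem_closedBall, dist_zero_right] at hz' ⊢
    rw [hn]
    exact mul_le_mul_of_nonneg_left hz' hc.le

/-- The big-loop-meeting predicate under dilation (`c > 0`). -/
theorem bigMeet_dilate_iff {c : ℝ} (hc : 0 < c) (R η : ℝ) (u : UnbasedLoop ℂ) :
    (((UnbasedLoop.imageOn (fun z ↦ (c : ℂ) * z) univ u).range ∩ closedBall (0 : ℂ) (c * R)).Nonempty ∧
        c * η ≤ diam (UnbasedLoop.imageOn (fun z ↦ (c : ℂ) * z) univ u).range) ↔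
      ((u.range ∩ closedBall (0 : ℂ) R).Nonempty ∧ η ≤ diam u.range) := by
  have hnorm : ‖(c : ℂ)‖ = c := by rw [Complex.norm_real, Real.norm_of_nonneg hc.le]
  rw [meets_dilate_iff hc, UVExpMoments.range_imageOn_mul, diam_smul₀, hnorm,
    mul_le_mul_iff_of_pos_left hc]

/-- **Counting big loops meeting a window in a translated family.** -/
theorem ncard_bigLoops_meeting_image_translate (b : ℂ) (L : Set (UnbasedLoop ℂ)) (ρ η : ℝ) :
    {u ∈ UnbasedLoop.map T[b] (isometry_translate b) '' L |
        (u.range ∩ closedBall b ρ).Nonempty ∧ η ≤ diam u.range}.ncard =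
      {u ∈ L | (u.range ∩ closedBall (0 : ℂ) ρ).Nonempty ∧ η ≤ diam u.range}.ncard :=
  BondTranslation.ncard_sep_image_translate b L _ _ fun u ↦ bigMeet_translate_iff b ρ η u

/-- **Counting big loops meeting a window in a dilated family** (`c > 0`). -/
theorem ncard_bigLoops_meeting_image_mul {c : ℝ} (hc : 0 < c) (L : Set (UnbasedLoop ℂ)) (R η : ℝ) :
    {u ∈ UnbasedLoop.imageOn (fun z ↦ (c : ℂ) * z) univ '' L |
        (u.range ∩ closedBall (0 : ℂ) (c * R)).Nonempty ∧ c * η ≤ diam u.range}.ncard =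
      {u ∈ L | (u.range ∩ closedBall (0 : ℂ) R).Nonempty ∧ η ≤ diam u.range}.ncard := by
  rw [sep_image_eq L _ _ fun u ↦ bigMeet_dilate_iff hc R η u,
    Set.ncard_image_of_injective _ (imageOn_mul_injective hc.ne')]

/-! ## §2 Pathwise near-translations; the deterministic bound at lattice scale -/

/-- **Pathwise near-translations, both lattices**: for `E ∈ latticeEnsembles`, `δ > 0`, every `x ∈ ℂ`
and every configuration `ω`, the loop set of `X_δ(ω)` is the translate, by a vector `b` with
`dist x b ≤ 2δ`, of the loop set of `X_δ(ω₀)` for some configuration `ω₀` (namely `ω` translated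
back; `BondTranslation.loops_zEns_relabel_shift`, `SiteTranslation.loops_tEns_relabel_shift`). -/
theorem exists_translate_loops_pathwise : ∀ E ∈ latticeEnsembles, ∀ {δ : ℝ}, 0 < δ →
    ∀ (x : ℂ) (ω : E.Ω), ∃ (b : ℂ) (ω₀ : E.Ω), dist x b ≤ 2 * δ ∧
      (E.X δ ω).loops = UnbasedLoop.map T[b] (isometry_translate b) '' (E.X δ ω₀).loops := by
  intro E hE δ hδ x ω
  simp only [latticeEnsembles, Set.mem_insert_iff, Set.mem_singleton_iff] at hE
  rcases hE with rfl | rfl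
  · obtain ⟨w, hw⟩ := SiteTranslation.exists_dist_meshPoint_le hδ x
    refine ⟨meshPoint δ w, BondConfig.relabel (sym2Equiv (Site.shift (-w))) ω, hw, ?_⟩
    have h := BondTranslation.loops_zEns_relabel_shift δ w
      (BondConfig.relabel (sym2Equiv (Site.shift (-w))) ω)
    have h' := BondTranslation.relabel_shift_neg_relabel_shift (-w) ω
    rw [neg_neg] at h'
    rwa [h'] at h
  · obtain ⟨w, hw⟩ := exists_dist_triMeshPoint_le hδ x
    refine ⟨triMeshPoint δ w, SiteConfig.relabel (Site.shift (-w)) ω, hw.trans (by linarith), ?_⟩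
    have h := SiteTranslation.loops_tEns_relabel_shift δ w (SiteConfig.relabel (Site.shift (-w)) ω)
    have h' := SiteTranslation.siteRelabel_shift_neg_shift (-w) ω
    rw [neg_neg] at h'
    rwa [h'] at h

/-- **At lattice scale the number of loops meeting a ball is deterministically bounded, uniformly in
the centre and the mesh**: for `E ∈ latticeEnsembles` and `K` there is `M` with
`#{u ∈ X_δ(ω) : trace u ∩ B̄(x, Kδ) ≠ ∅} ≤ M` (a finite set) for all `δ > 0`, `x`, `ω` — translate `x`
near `0` (§2), dilate to mesh `1` (`loops_mul_latticeEnsembles`), and count the loops of `X_1` meeting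
`B̄(0, K + 2)` (`FirstMoment.exists_ncard_loops_meeting_le`). -/
theorem exists_ncard_loops_meeting_smallBall_le : ∀ E ∈ latticeEnsembles, ∀ K : ℝ, ∃ M : ℕ,
    ∀ {δ : ℝ}, 0 < δ → ∀ (x : ℂ) (ω : E.Ω),
      {u ∈ (E.X δ ω).loops | (u.range ∩ closedBall x (K * δ)).Nonempty}.Finite ∧
      {u ∈ (E.X δ ω).loops | (u.range ∩ closedBall x (K * δ)).Nonempty}.ncard ≤ M := by
  intro E hE K
  obtain ⟨M, hM⟩ := FirstMoment.exists_ncard_loops_meeting_le E hE one_pos (K + 2)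
  refine ⟨M, fun {δ} hδ x ω ↦ ?_⟩
  obtain ⟨b, ω₀, hxb, hL⟩ := exists_translate_loops_pathwise E hE hδ x ω
  obtain ⟨hfin₁, hle₁⟩ := hM ω₀
  have hX : E.X δ ω₀ = E.X (δ * 1) ω₀ := by rw [mul_one]
  have hS₀ : {u ∈ (E.X δ ω₀).loops | (u.range ∩ closedBall (0 : ℂ) (K * δ + 2 * δ)).Nonempty} =
      UnbasedLoop.imageOn (fun z ↦ (δ : ℂ) * z) univ ''
        {u ∈ (E.X 1 ω₀).loops | (u.range ∩ closedBall (0 : ℂ) (K + 2)).Nonempty} := by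
    rw [hX, loops_mul_latticeEnsembles E hE δ 1 ω₀]
    refine sep_image_eq _ _ _ fun u ↦ ?_
    rw [show K * δ + 2 * δ = δ * (K + 2) by ring]
    exact meets_dilate_iff hδ (K + 2) u
  have hfin₀ : {u ∈ (E.X δ ω₀).loops |
      (u.range ∩ closedBall (0 : ℂ) (K * δ + 2 * δ)).Nonempty}.Finite := by
    rw [hS₀]; exact hfin₁.image _
  have hle₀ : {u ∈ (E.X δ ω₀).loops |
      (u.range ∩ closedBall (0 : ℂ) (K * δ + 2 * δ)).Nonempty}.ncard ≤ M := by
    rw [hS₀]; exact (Set.ncard_image_le hfin₁).trans hle₁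
  have hsub : {u ∈ (E.X δ ω₀).loops | (u.range ∩ closedBall (x - b) (K * δ)).Nonempty} ⊆
      {u ∈ (E.X δ ω₀).loops | (u.range ∩ closedBall (0 : ℂ) (K * δ + 2 * δ)).Nonempty} := by
    rintro u ⟨hu, z, hz, hz'⟩
    refine ⟨hu, z, hz, ?_⟩
    rw [mem_closedBall, dist_zero_right]
    rw [mem_closedBall, dist_eq_norm] at hz'
    have hxb' : ‖x - b‖ ≤ 2 * δ := by rwa [← dist_eq_norm]
    calc ‖z‖ = ‖z - (x - b) + (x - b)‖ := by rw [sub_add_cancel]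
      _ ≤ ‖z - (x - b)‖ + ‖x - b‖ := norm_add_le _ _
      _ ≤ K * δ + 2 * δ := add_le_add hz' hxb'
  have hSx : {u ∈ (E.X δ ω).loops | (u.range ∩ closedBall x (K * δ)).Nonempty} =
      UnbasedLoop.map T[b] (isometry_translate b) ''
        {u ∈ (E.X δ ω₀).loops | (u.range ∩ closedBall (x - b) (K * δ)).Nonempty} := by
    rw [hL]; exact sep_image_eq _ _ _ fun u ↦ meets_translate_iff b x _ u
  rw [hSx]
  exact ⟨(hfin₀.subset hsub).image _,
    (Set.ncard_image_le (hfin₀.subset hsub)).trans ((ncard_le_ncard hsub hfin₀).trans hle₀)⟩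

/-- Integrability of `exp(a · #{loops meeting B̄(x, ρ), Q})` at a fixed mesh, any centre. -/
theorem integrable_exp_mul_ncard_loops_meeting : ∀ E ∈ latticeEnsembles, ∀ {δ : ℝ}, 0 < δ →
    ∀ (x : ℂ) (ρ a : ℝ) (Q : UnbasedLoop ℂ → Prop), (∀ u, Q u → (u.range ∩ closedBall x ρ).Nonempty) →
      Integrable (fun ω ↦ Real.exp (a * ({u ∈ (E.X δ ω).loops | Q u}.ncard : ℝ))) E.P := by
  intro E hE δ hδ x ρ a Q hQ
  haveI := isProbabilityMeasure_of_mem hE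
  have hQ' : ∀ u, Q u → (u.range ∩ closedBall (0 : ℂ) (‖x‖ + ρ)).Nonempty := fun u hu ↦ by
    obtain ⟨z, hz, hz'⟩ := hQ u hu
    refine ⟨z, hz, ?_⟩
    rw [mem_closedBall, dist_zero_right]
    rw [mem_closedBall, dist_eq_norm] at hz'
    calc ‖z‖ = ‖z - x + x‖ := by rw [sub_add_cancel]
      _ ≤ ‖z - x‖ + ‖x‖ := norm_add_le _ _
      _ ≤ ‖x‖ + ρ := by linarith
  obtain ⟨N, hN⟩ := BigLoopsMeet.exists_ncard_loops_sep_meeting_le E hE hδ (‖x‖ + ρ)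
  have hmeas : Measurable fun ω ↦ ({u ∈ (E.X δ ω).loops | Q u}.ncard : ℝ) :=
    measurable_from_nat.comp (BigLoops.measurable_ncard_loops_sep E hE δ Q)
  refine Integrable.of_bound (Real.measurable_exp.comp (hmeas.const_mul a)).aestronglyMeasurable
    (Real.exp (|a| * N)) (Eventually.of_forall fun ω ↦ ?_)
  rw [Real.norm_eq_abs, Real.abs_exp]
  refine Real.exp_le_exp.2 ?_
  have h1 : ({u ∈ (E.X δ ω).loops | Q u}.ncard : ℝ) ≤ N := by exact_mod_cast (hN Q hQ' ω).2
  have h2 : (0 : ℝ) ≤ ({u ∈ (E.X δ ω).loops | Q u}.ncard : ℝ) := Nat.cast_nonneg _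
  calc a * ({u ∈ (E.X δ ω).loops | Q u}.ncard : ℝ)
      ≤ |a| * ({u ∈ (E.X δ ω).loops | Q u}.ncard : ℝ) := mul_le_mul_of_nonneg_right (le_abs_self a) h2
    _ ≤ |a| * N := mul_le_mul_of_nonneg_left h1 (abs_nonneg a)

/-! ## §3 K6 for the loops meeting a window: all scales, all centres, no mesh constraint -/

/-- **K6 for the loops meeting a window, at ALL SCALES at centre `0`** (exact dilation covariance
`loops_mul_latticeEnsembles` applied to `expMoment_ncard_bigLoops_meeting_le` at mesh `δ/λ`). -/
theorem expMoment_ncard_bigLoops_meeting_le_scale : ∀ E ∈ latticeEnsembles, ∀ (s R η : ℝ), 0 < η → η ≤ R →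
    ∃ C c₀ : ℝ, 0 < C ∧ 0 < c₀ ∧ ∀ (l δ : ℝ), 0 < l → 0 < δ → c₀ * δ ≤ l * η →
      Integrable (fun ω ↦ Real.exp (s * ({u ∈ (E.X δ ω).loops |
        (u.range ∩ Metric.closedBall (0 : ℂ) (l * R)).Nonempty ∧ l * η ≤ Metric.diam u.range}.ncard : ℝ))) E.P ∧
      ∫ ω, Real.exp (s * ({u ∈ (E.X δ ω).loops |
        (u.range ∩ Metric.closedBall (0 : ℂ) (l * R)).Nonempty ∧ l * η ≤ Metric.diam u.range}.ncard : ℝ)) ∂E.P ≤ C := by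
  intro E hE s R η hη hηR
  obtain ⟨C, c₀, hC, hc₀, h⟩ := expMoment_ncard_bigLoops_meeting_le E hE s R η hη hηR
  refine ⟨C, c₀, hC, hc₀, fun l δ hl hδ hcδ ↦ ?_⟩
  have key : ∀ ω, ({u ∈ (E.X δ ω).loops |
      (u.range ∩ Metric.closedBall (0 : ℂ) (l * R)).Nonempty ∧ l * η ≤ Metric.diam u.range}.ncard : ℝ) =
      ({u ∈ (E.X (δ / l) ω).loops |
        (u.range ∩ Metric.closedBall (0 : ℂ) R).Nonempty ∧ η ≤ Metric.diam u.range}.ncard : ℝ) := fun ω ↦ by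
    have hX : E.X δ ω = E.X (l * (δ / l)) ω := by rw [mul_div_cancel₀ _ hl.ne']
    rw [hX, loops_mul_latticeEnsembles E hE l (δ / l) ω, ncard_bigLoops_meeting_image_mul hl]
  simp_rw [key]
  exact h (δ / l) (div_pos hδ hl) (by rw [← mul_div_assoc, div_le_iff₀ hl]; linarith)

end BigLoopsMeetBall

open BigLoopsMeetBall in
/-- **K6 for the loops MEETING a window, at ALL CENTRES and ALL SCALES, with NO mesh constraint, both
lattices** (registered helper toward Ξ₂ `uvFarBiteSq_expMoment_latticeEnsembles`, line
`positive-cone-weight-doubling`).  For `E ∈ latticeEnsembles` and all `s R η` (`0 < η ≤ R`) there is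
`C > 0` such that for EVERY centre `x ∈ ℂ`, EVERY scale `λ > 0` and EVERY mesh `δ > 0`, the number of
loops of `X_δ` of diameter `≥ λη` whose trace meets `B̄(x, λR)` has `E_δ[exp(s · #)] ≤ C`
(integrability included).  Above lattice scale (`c₀δ ≤ λη`): move `x` to a `2δ`-close law-preserving
translation vector (`SiteTranslation.exists_near_translate_loops_latticeEnsembles`), enlarge the
window to `B̄(b, λ(R + 2η))`, and use the all-scale bound at centre `0`; below lattice scale the count
is at most the deterministic `M` of `exists_ncard_loops_meeting_smallBall_le`. -/
theorem expMoment_ncard_bigLoops_meeting_le_ball : ∀ E ∈ latticeEnsembles, ∀ (s R η : ℝ), 0 < η → η ≤ R →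
    ∃ C : ℝ, 0 < C ∧ ∀ (x : ℂ) (l δ : ℝ), 0 < l → 0 < δ →
      Integrable (fun ω ↦ Real.exp (s * ({u ∈ (E.X δ ω).loops |
        (u.range ∩ Metric.closedBall x (l * R)).Nonempty ∧ l * η ≤ Metric.diam u.range}.ncard : ℝ))) E.P ∧
      ∫ ω, Real.exp (s * ({u ∈ (E.X δ ω).loops |
        (u.range ∩ Metric.closedBall x (l * R)).Nonempty ∧ l * η ≤ Metric.diam u.range}.ncard : ℝ)) ∂E.P ≤ C := by
  intro E hE s R η hη hηR
  haveI := isProbabilityMeasure_of_mem hE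
  have hR : 0 < R := lt_of_lt_of_le hη hηR
  obtain ⟨C₁, c₀, hC₁, hc₀, h⟩ :=
    expMoment_ncard_bigLoops_meeting_le_scale E hE (max s 0) (R + 2 * η) η hη (by linarith)
  set c₁ : ℝ := max c₀ 1 with hc₁
  have hc₁0 : 0 < c₁ := lt_of_lt_of_le one_pos (le_max_right _ _)
  obtain ⟨M, hM⟩ := exists_ncard_loops_meeting_smallBall_le E hE (c₁ * R / η)
  have hint : ∀ {δ : ℝ}, 0 < δ → ∀ (a : ℝ) (y : ℂ) (ρ θ : ℝ), Integrable (fun ω ↦ Real.exp (a *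
      ({u ∈ (E.X δ ω).loops | (u.range ∩ closedBall y ρ).Nonempty ∧ θ ≤ diam u.range}.ncard : ℝ))) E.P :=
    fun hδ a y ρ θ ↦ integrable_exp_mul_ncard_loops_meeting E hE hδ y ρ a _ fun _ hu ↦ hu.1
  refine ⟨max C₁ (Real.exp (max s 0 * M)), lt_max_of_lt_left hC₁, fun x l δ hl hδ ↦ ⟨hint hδ s x _ _, ?_⟩⟩
  -- reduce to the order `max s 0`
  have hmono : ∫ ω, Real.exp (s * ({u ∈ (E.X δ ω).loops |
        (u.range ∩ closedBall x (l * R)).Nonempty ∧ l * η ≤ diam u.range}.ncard : ℝ)) ∂E.P ≤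
      ∫ ω, Real.exp (max s 0 * ({u ∈ (E.X δ ω).loops |
        (u.range ∩ closedBall x (l * R)).Nonempty ∧ l * η ≤ diam u.range}.ncard : ℝ)) ∂E.P :=
    integral_mono (hint hδ s x _ _) (hint hδ _ x _ _) fun ω ↦
      Real.exp_le_exp.2 (mul_le_mul_of_nonneg_right (le_max_left _ _) (Nat.cast_nonneg _))
  refine hmono.trans ?_
  by_cases hscale : c₁ * δ ≤ l * η
  · -- above lattice scale: near-translation, enlarged window, all-scale bound at centre 0
    have hc₀δ : c₀ * δ ≤ l * η := le_trans (mul_le_mul_of_nonneg_right (le_max_left _ _) hδ.le) hscale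
    have hδl : δ ≤ l * η := le_trans (by nlinarith [le_max_right c₀ 1]) hscale
    obtain ⟨b, hxb, hlaw⟩ := SiteTranslation.exists_near_translate_loops_latticeEnsembles E hE hδ x
    have hball : closedBall x (l * R) ⊆ closedBall b (l * (R + 2 * η)) :=
      closedBall_subset_closedBall' (by nlinarith [dist_comm x b])
    obtain ⟨N, hN⟩ := BigLoopsMeet.exists_ncard_loops_sep_meeting_le E hE hδ (‖b‖ + l * (R + 2 * η))
    have hfin : ∀ ω, {u ∈ (E.X δ ω).loops | (u.range ∩ closedBall b (l * (R + 2 * η))).Nonempty ∧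
        l * η ≤ diam u.range}.Finite := fun ω ↦ (hN _ (fun u hu ↦ by
          obtain ⟨z, hz, hz'⟩ := hu.1
          refine ⟨z, hz, ?_⟩
          rw [mem_closedBall, dist_zero_right]
          rw [mem_closedBall, dist_eq_norm] at hz'
          calc ‖z‖ = ‖z - b + b‖ := by rw [sub_add_cancel]
            _ ≤ ‖z - b‖ + ‖b‖ := norm_add_le _ _
            _ ≤ ‖b‖ + l * (R + 2 * η) := by linarith) ω).1
    have hlaw' := hlaw fun L ↦ Real.exp (max s 0 * ({u ∈ L |
      (u.range ∩ closedBall b (l * (R + 2 * η))).Nonempty ∧ l * η ≤ diam u.range}.ncard : ℝ))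
    simp only [ncard_bigLoops_meeting_image_translate] at hlaw'
    calc ∫ ω, Real.exp (max s 0 * ({u ∈ (E.X δ ω).loops |
            (u.range ∩ closedBall x (l * R)).Nonempty ∧ l * η ≤ diam u.range}.ncard : ℝ)) ∂E.P
        ≤ ∫ ω, Real.exp (max s 0 * ({u ∈ (E.X δ ω).loops |
            (u.range ∩ closedBall b (l * (R + 2 * η))).Nonempty ∧ l * η ≤ diam u.range}.ncard : ℝ)) ∂E.P := by
          refine integral_mono (hint hδ _ x _ _) (hint hδ _ b _ _) fun ω ↦ Real.exp_le_exp.2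
            (mul_le_mul_of_nonneg_left ?_ (le_max_right _ _))
          have hsub : {u ∈ (E.X δ ω).loops | (u.range ∩ closedBall x (l * R)).Nonempty ∧
                l * η ≤ diam u.range} ⊆
              {u ∈ (E.X δ ω).loops | (u.range ∩ closedBall b (l * (R + 2 * η))).Nonempty ∧
                l * η ≤ diam u.range} :=
            fun u hu ↦ ⟨hu.1, hu.2.1.mono (Set.inter_subset_inter_right _ hball), hu.2.2⟩
          exact_mod_cast ncard_le_ncard hsub (hfin ω)
      _ = ∫ ω, Real.exp (max s 0 * ({u ∈ (E.X δ ω).loops |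
            (u.range ∩ closedBall (0 : ℂ) (l * (R + 2 * η))).Nonempty ∧ l * η ≤ diam u.range}.ncard : ℝ)) ∂E.P :=
          hlaw'.symm
      _ ≤ C₁ := (h l δ hl hδ hc₀δ).2
      _ ≤ max C₁ (Real.exp (max s 0 * M)) := le_max_left _ _
  · -- below lattice scale: at most `M` loops meet the window
    push Not at hscale
    have hlR : l * R ≤ c₁ * R / η * δ := by
      rw [div_mul_eq_mul_div, le_div_iff₀ hη]
      nlinarith [hscale.le, hR.le]
    have hbound : ∀ ω, ({u ∈ (E.X δ ω).loops |
        (u.range ∩ closedBall x (l * R)).Nonempty ∧ l * η ≤ diam u.range}.ncard : ℝ) ≤ M := fun ω ↦ by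
      obtain ⟨hfinM, hleM⟩ := hM hδ x ω
      have hsub : {u ∈ (E.X δ ω).loops | (u.range ∩ closedBall x (l * R)).Nonempty ∧
          l * η ≤ diam u.range} ⊆
          {u ∈ (E.X δ ω).loops | (u.range ∩ closedBall x (c₁ * R / η * δ)).Nonempty} :=
        fun u hu ↦ ⟨hu.1, hu.2.1.mono (Set.inter_subset_inter_right _ (closedBall_subset_closedBall hlR))⟩
      exact_mod_cast (ncard_le_ncard hsub hfinM).trans hleM
    calc ∫ ω, Real.exp (max s 0 * ({u ∈ (E.X δ ω).loops |
            (u.range ∩ closedBall x (l * R)).Nonempty ∧ l * η ≤ diam u.range}.ncard : ℝ)) ∂E.P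
        ≤ ∫ _ω, Real.exp (max s 0 * M) ∂E.P :=
          integral_mono (hint hδ _ x _ _) (integrable_const _) fun ω ↦
            Real.exp_le_exp.2 (mul_le_mul_of_nonneg_left (hbound ω) (le_max_right _ _))
      _ = Real.exp (max s 0 * M) := by rw [integral_const, probReal_univ, one_smul]
      _ ≤ max C₁ (Real.exp (max s 0 * M)) := le_max_right _ _

open BigLoopsMeetBall in
/-- **K6 for the loops INSIDE a window, at all centres and all scales, with NO mesh constraint, both
lattices**: for `E ∈ latticeEnsembles` and `s R η` (`0 < η ≤ R`) there is `C > 0` with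
`E_δ[exp(s · #{u ∈ X_δ : trace u ⊆ B(x, λR), diam ≥ λη})] ≤ C` for every `x`, `λ > 0`, `δ > 0`
(the confined count is dominated by the meeting count of `expMoment_ncard_bigLoops_meeting_le_ball`). -/
theorem expMoment_ncard_bigLoops_le_ball_free : ∀ E ∈ latticeEnsembles, ∀ (s R η : ℝ), 0 < η → η ≤ R →
    ∃ C : ℝ, 0 < C ∧ ∀ (x : ℂ) (l δ : ℝ), 0 < l → 0 < δ →
      Integrable (fun ω ↦ Real.exp (s * ({u ∈ (E.X δ ω).loops |
        u.range ⊆ Metric.ball x (l * R) ∧ l * η ≤ Metric.diam u.range}.ncard : ℝ))) E.P ∧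
      ∫ ω, Real.exp (s * ({u ∈ (E.X δ ω).loops |
        u.range ⊆ Metric.ball x (l * R) ∧ l * η ≤ Metric.diam u.range}.ncard : ℝ)) ∂E.P ≤ C := by
  intro E hE s R η hη hηR
  haveI := isProbabilityMeasure_of_mem hE
  obtain ⟨C, hC, h⟩ := expMoment_ncard_bigLoops_meeting_le_ball E hE (max s 0) R η hη hηR
  refine ⟨C, hC, fun x l δ hl hδ ↦ ?_⟩
  have hint : ∀ a : ℝ, Integrable (fun ω ↦ Real.exp (a * ({u ∈ (E.X δ ω).loops |
      u.range ⊆ ball x (l * R) ∧ l * η ≤ diam u.range}.ncard : ℝ))) E.P := fun a ↦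
    integrable_expMoment_ncard_bigLoops_ball E hE a x _ _ δ hδ
  refine ⟨hint s, ?_⟩
  obtain ⟨N, hN⟩ := BigLoopsMeet.exists_ncard_loops_sep_meeting_le E hE hδ (‖x‖ + l * R)
  have hfin : ∀ ω, {u ∈ (E.X δ ω).loops | (u.range ∩ closedBall x (l * R)).Nonempty ∧
      l * η ≤ diam u.range}.Finite := fun ω ↦ (hN _ (fun u hu ↦ by
        obtain ⟨z, hz, hz'⟩ := hu.1
        refine ⟨z, hz, ?_⟩
        rw [mem_closedBall, dist_zero_right]
        rw [mem_closedBall, dist_eq_norm] at hz'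
        calc ‖z‖ = ‖z - x + x‖ := by rw [sub_add_cancel]
          _ ≤ ‖z - x‖ + ‖x‖ := norm_add_le _ _
          _ ≤ ‖x‖ + l * R := by linarith) ω).1
  calc ∫ ω, Real.exp (s * ({u ∈ (E.X δ ω).loops |
          u.range ⊆ ball x (l * R) ∧ l * η ≤ diam u.range}.ncard : ℝ)) ∂E.P
      ≤ ∫ ω, Real.exp (max s 0 * ({u ∈ (E.X δ ω).loops |
          u.range ⊆ ball x (l * R) ∧ l * η ≤ diam u.range}.ncard : ℝ)) ∂E.P :=
        integral_mono (hint s) (hint _) fun ω ↦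
          Real.exp_le_exp.2 (mul_le_mul_of_nonneg_right (le_max_left _ _) (Nat.cast_nonneg _))
    _ ≤ ∫ ω, Real.exp (max s 0 * ({u ∈ (E.X δ ω).loops |
          (u.range ∩ closedBall x (l * R)).Nonempty ∧ l * η ≤ diam u.range}.ncard : ℝ)) ∂E.P := by
        refine integral_mono (hint _) (h x l δ hl hδ).1 fun ω ↦ Real.exp_le_exp.2
          (mul_le_mul_of_nonneg_left ?_ (le_max_right _ _))
        have hsub : {u ∈ (E.X δ ω).loops | u.range ⊆ ball x (l * R) ∧ l * η ≤ diam u.range} ⊆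
            {u ∈ (E.X δ ω).loops | (u.range ∩ closedBall x (l * R)).Nonempty ∧ l * η ≤ diam u.range} :=
          fun u hu ↦ ⟨hu.1, by
            obtain ⟨z, hz⟩ := u.range_nonempty
            exact ⟨z, hz, ball_subset_closedBall (hu.2.1 hz)⟩, hu.2.2⟩
        exact_mod_cast ncard_le_ncard hsub (hfin ω)
    _ ≤ C := (h x l δ hl hδ).2

end Summit.CriticalPhenomena.CardyFormulaZ2.Cruxes.NestingRigidity.PositiveConeWeightDoubling

end
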